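import Summits.Ventures.WeilGRH.TwistedSechTableDiag
import Summits.Ventures.WeilGRH.TwistedSechSeriesHalf
import HarnessLib

/-!
# GRH arm (rh-explicit, venture WeilGRH): the `sech` block tables with the HALF-TERM correction (`O(K⁻³)` boxes)

Cell `rh-explicit`, WEIL TRACK — GRH ARM (engine seat weil-grh-2 gen9).  Version 2 of the interval boxes of
`TwistedSechTable.lean` / `TwistedSechTableDiag.lean` (gen8): the alternating exponential expansion of
`σ(t) = 1/(2cosh(t/2))` is summed to `K` terms PLUS HALF of term `K` (first Euler-transform step,
`TwistedSechSeriesHalf.abs_integral_sech_mul_sub_sum_half_le`), so the truncation remainder of every table entry drops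
from `c/(K+½)²` to `c/(K+½)³` (`c = ω_n` for the sine values, `2aω_n² + 1/a` on the diagonal); the partial sums are gen8's `sinSum` / `diagSum` (whose `expSeq` sub-terms the kernel shares), only
the half term and the cubic remainder are new:

* per mode: `abs_sechSin_sub_sum_half_le`, `abs_sechDiag_sub_sum_half_le`;
* boxes: `SechEncl.halfSigned`, `sinBoxH`, `diagBoxH` with ★ `mem_sinBoxH` (`I_n ∈ sinBoxH`) and ★ `mem_diagBoxH`
  (`sechIncrCoeff a n n ∈ diagBoxH`);
* the kernel checkers of literal tables (same validity conclusions as gen8's `checkSinTab` / `checkDiagTab`, so the cell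
  checker `TwistedGramCellCheckH.lean` consumes v2 tables unchanged) are the sequel `TwistedSechTableHalfCheck.lean`.

Sizing: `K = 64` with the half term beats `K = 512` without it (`64.5³ = 2.7·10⁵ ≈ 512.5²`): at equal kernel cost the
entry radius drops by `≈ 1/K` (measured at `a = 59/100`, `K = 512`: sine widths ≤ `2.5e−6`, diagonal ≤ `2.4e−5`, against
`7e−4` / `2.5e−3` for the gen8 boxes), which is what the cell `(−3/·) @ 59/100` (blocks `8 × 32`, margin `2.5e−3`) needs.
Everything is PROVED; computable `def`s with docstrings; no named facts; RH/GRH-free; standard axioms.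
References: H. Yoshida (1992) §5 [Yoshida1992HermitianForms]; R. E. Moore (1966) Ch. 3 [Moore1966].
-/

set_option autoImplicit false

open Real MeasureTheory Set Finset
open scoped BigOperators

namespace Summit.Ventures.WeilGRH

open Literature.Analysis.ValidatedNumerics.NumericsMP
open Summit.RiemannHypothesis.RiemannHypothesis.Theorems.WeilFormatC

namespace SechEncl

variable {a : ℝ}

/-! ## Per-mode remainders with the half term -/

/-- **Sine value with the half term**: `|I_n − Σ_{k<K} (−1)^k s_k − ((−1)^K/2) s_K| ≤ ω/(K+½)³`,
`s_k = ω(1 − E_k)/(l_k² + ω²)`, `ω = πn/a`, `E_k = e^{−2a(k+½)}`. -/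
theorem abs_sechSin_sub_sum_half_le (ha : 0 < a) (n : ℕ) (K : ℕ) :
    |(∫ t in Ioc 0 (2 * a), 1 / (2 * Real.cosh (t / 2)) * Real.sin (π * n / a * t))
        - (∑ k ∈ Finset.range K, (-1 : ℝ) ^ k *
          ((π * n / a) * (1 - Real.exp (-((k + 1 / 2) * (2 * a)))) / ((k + 1 / 2) ^ 2 + (π * n / a) ^ 2)))
        - (-1 : ℝ) ^ K / 2 *
          ((π * n / a) * (1 - Real.exp (-((K + 1 / 2) * (2 * a)))) / ((K + 1 / 2) ^ 2 + (π * n / a) ^ 2))|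
      ≤ (π * n / a) / (K + 1 / 2) ^ 3 := by
  have hω : 0 ≤ π * n / a := by positivity
  have hterm : ∀ k : ℕ, (π * n / a) * (1 - Real.exp (-((k + 1 / 2) * (2 * a)))) / ((k + 1 / 2) ^ 2 + (π * n / a) ^ 2)
      = ∫ t in Ioc 0 (2 * a), Real.exp (-((k + 1 / 2) * t)) * Real.sin (π * n / a * t) := by
    intro k
    have hl : (0 : ℝ) < k + 1 / 2 := by positivity
    have h := sinClosed_eq ha (n : ℤ) hl
    push_cast at h ⊢
    rw [h]
  have hsum : ∑ k ∈ Finset.range K, (-1 : ℝ) ^ k *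
      ((π * n / a) * (1 - Real.exp (-((k + 1 / 2) * (2 * a)))) / ((k + 1 / 2) ^ 2 + (π * n / a) ^ 2))
      = ∑ k ∈ Finset.range K, (-1 : ℝ) ^ k *
          ∫ t in Ioc 0 (2 * a), Real.exp (-((k + 1 / 2) * t)) * Real.sin (π * n / a * t) :=
    Finset.sum_congr rfl fun k _ ↦ by rw [hterm k]
  rw [hsum, hterm K]
  refine abs_integral_sech_mul_sub_sum_half_le (F := fun t ↦ Real.sin (π * n / a * t)) (by fun_prop) hω
    (fun t ht ↦ ?_) K
  have h := abs_offDiag_kernel_le (π * n / a) 0 ht.1.le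
  simpa [abs_of_nonneg hω] using h

/-- **Diagonal entry with the half term**: with `D_k` the diagonal closed form of `TwistedSechTableDiag.diagClosed_eq`,
`|sechIncrCoeff a n n − (2π − 4 arctan e^{a}) − Σ_{k<K} (−1)^k D_k − ((−1)^K/2) D_K| ≤ (2aω² + 1/a)/(K+½)³`. -/
theorem abs_sechDiag_sub_sum_half_le (ha : 0 < a) (n : ℕ) (K : ℕ) :
    |sechIncrCoeff a n n - (2 * π - 4 * Real.arctan (Real.exp a))
        - (∑ k ∈ Finset.range K, (-1 : ℝ) ^ k *
          (2 * ((1 - Real.exp (-((k + 1 / 2) * (2 * a)))) / (k + 1 / 2))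
            - 2 * ((k + 1 / 2) * (1 - Real.exp (-((k + 1 / 2) * (2 * a)))) / ((k + 1 / 2) ^ 2 + (π * n / a) ^ 2))
            + (1 / a) * (((k + 1 / 2) ^ 2 - (π * n / a) ^ 2) * (1 - Real.exp (-((k + 1 / 2) * (2 * a))))
                  / ((k + 1 / 2) ^ 2 + (π * n / a) ^ 2) ^ 2
                - (2 * a) * Real.exp (-((k + 1 / 2) * (2 * a))) * (k + 1 / 2) / ((k + 1 / 2) ^ 2 + (π * n / a) ^ 2))))
        - (-1 : ℝ) ^ K / 2 *
          (2 * ((1 - Real.exp (-((K + 1 / 2) * (2 * a)))) / (K + 1 / 2))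
            - 2 * ((K + 1 / 2) * (1 - Real.exp (-((K + 1 / 2) * (2 * a)))) / ((K + 1 / 2) ^ 2 + (π * n / a) ^ 2))
            + (1 / a) * (((K + 1 / 2) ^ 2 - (π * n / a) ^ 2) * (1 - Real.exp (-((K + 1 / 2) * (2 * a))))
                  / ((K + 1 / 2) ^ 2 + (π * n / a) ^ 2) ^ 2
                - (2 * a) * Real.exp (-((K + 1 / 2) * (2 * a))) * (K + 1 / 2) / ((K + 1 / 2) ^ 2 + (π * n / a) ^ 2)))|
      ≤ (2 * a * (π * n / a) ^ 2 + 1 / a) / (K + 1 / 2) ^ 3 := by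
  have hterm : ∀ k : ℕ,
      (2 * ((1 - Real.exp (-((k + 1 / 2) * (2 * a)))) / (k + 1 / 2))
        - 2 * ((k + 1 / 2) * (1 - Real.exp (-((k + 1 / 2) * (2 * a)))) / ((k + 1 / 2) ^ 2 + (π * n / a) ^ 2))
        + (1 / a) * (((k + 1 / 2) ^ 2 - (π * n / a) ^ 2) * (1 - Real.exp (-((k + 1 / 2) * (2 * a))))
              / ((k + 1 / 2) ^ 2 + (π * n / a) ^ 2) ^ 2
            - (2 * a) * Real.exp (-((k + 1 / 2) * (2 * a))) * (k + 1 / 2) / ((k + 1 / 2) ^ 2 + (π * n / a) ^ 2)))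
      = ∫ t in Ioc 0 (2 * a), Real.exp (-((k + 1 / 2) * t)) * (2 - 2 * (1 - t / (2 * a)) * Real.cos (π * n / a * t)) := by
    intro k
    have hl : (0 : ℝ) < k + 1 / 2 := by positivity
    have h := diagClosed_eq ha (n : ℤ) hl
    push_cast at h ⊢
    rw [h]
  have hsum := Finset.sum_congr (rfl : Finset.range K = Finset.range K) fun k (_ : k ∈ Finset.range K) ↦
    congrArg (fun x ↦ (-1 : ℝ) ^ k * x) (hterm k)
  have hK := hterm K
  have hentry : sechIncrCoeff a n n - (2 * π - 4 * Real.arctan (Real.exp a)) =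
      ∫ t in Ioc 0 (2 * a), 1 / (2 * Real.cosh (t / 2)) * (2 - 2 * (1 - t / (2 * a)) * Real.cos (π * n / a * t)) := by
    unfold sechIncrCoeff
    rw [if_pos rfl, integral_sech_density_mul_two_Ioi]
    push_cast
    ring
  rw [hsum, hK, hentry]
  exact abs_integral_sech_mul_sub_sum_half_le (by fun_prop) (by positivity)
    (fun t ht ↦ abs_diag_kernel_le ha _ ht) K

/-! ## Interval boxes with the half term -/

section Boxes

variable {S : ℕ}

/-- `acc ± t/2` according to the parity of `K`: the box of `x + ((−1)^K/2)·y`.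
[cite: Moore1966, Ch. 3 (interval arithmetic: inclusion property)] -/
def halfSigned (K : ℕ) (acc t : MI) : MI := if K % 2 = 0 then acc.add (t.divNat 2) else acc.sub (t.divNat 2)

/-- `halfSigned` encloses `x + ((−1)^K/2)·y`. [cite: Moore1966, Ch. 3 (interval arithmetic: inclusion property)] -/
theorem mem_halfSigned {K : ℕ} {acc t : MI} {x y : ℝ} (hx : MI.mem S x acc) (hy : MI.mem S y t) :
    MI.mem S (x + (-1 : ℝ) ^ K / 2 * y) (halfSigned K acc t) := by
  have hh : MI.mem S (y / (2 : ℕ)) (t.divNat 2) := MI.mem_divNat hy (by norm_num)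
  unfold halfSigned
  by_cases hK : K % 2 = 0
  · rw [if_pos hK]
    have hs : (-1 : ℝ) ^ K = 1 := by
      obtain ⟨j, hj⟩ := Nat.even_iff.mpr hK; rw [hj, ← two_mul, pow_mul]; norm_num
    have e : x + (-1 : ℝ) ^ K / 2 * y = x + y / (2 : ℕ) := by rw [hs]; push_cast; ring
    rw [e]; exact MI.mem_add hx hh
  · rw [if_neg hK]
    have hs : (-1 : ℝ) ^ K = -1 := by
      have hK' : K % 2 = 1 := Nat.mod_two_ne_zero.mp hK
      obtain ⟨j, hj⟩ := Nat.odd_iff.mpr hK'; rw [hj, pow_succ, pow_mul]; norm_num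
    have e : x + (-1 : ℝ) ^ K / 2 * y = x - y / (2 : ℕ) := by rw [hs]; push_cast; ring
    rw [e]; exact MI.mem_sub hx hh

/-- **The sine value box, v2**: `K` terms + half of term `K` (linear time), widened by `⌈8·max(Ω.hi,0)/(2K+1)³⌉`.
[cite: Moore1966, Ch. 3 (interval arithmetic: inclusion property)] -/
def sinBoxH (S : ℕ) (Ω E0 R : MI) (K : ℕ) : Option MI :=
  match sinSum S Ω E0 R K, sinTerm S Ω (expSeq S E0 R K) K with
  | some Y, some t => some ((halfSigned K Y t).widen (cdiv (8 * max Ω.hi 0) ((2 * (K : ℤ) + 1) ^ 3)))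
  | _, _ => none

/-- ★ `sinBoxH` encloses `I_n = ∫_{(0,2a]} σ(t) sin(πn t/a) dt` (`Ω ∋ πn/a`).
[cite: Moore1966, Ch. 3 (interval arithmetic: inclusion property)] -/
theorem mem_sinBoxH (hS : 0 < S) (ha : 0 < a) {P A Ω E0 R : MI} (hP : MI.mem S Real.pi P) (hA : MI.mem S a A)
    {n : ℕ} (hΩ : omegaBox S P A n = some Ω) (hE0 : MI.mem S (Real.exp (-a)) E0)
    (hR : MI.mem S (Real.exp (-(2 * a))) R) {K : ℕ} {Y : MI} (h : sinBoxH S Ω E0 R K = some Y) :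
    MI.mem S (∫ t in Ioc 0 (2 * a), 1 / (2 * Real.cosh (t / 2)) * Real.sin (π * n / a * t)) Y := by
  have hω := mem_omegaBox hS hP hA hΩ
  unfold sinBoxH at h
  split at h
  · rename_i Z t hZ ht
    simp only [Option.some.injEq] at h
    subst h
    have hZm := mem_sinSum hS hω hE0 hR K hZ
    have htm := mem_sinTerm hS hω (mem_expSeq hS hE0 hR K) ht
    have hsum := mem_halfSigned (K := K) hZm htm
    refine MI.mem_widen hsum ?_
    have hrem := abs_sechSin_sub_sum_half_le ha n K
    have hωS : π * n / a * S ≤ ((max Ω.hi 0 : ℤ) : ℝ) := by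
      have := hω.2; push_cast; exact this.trans (by exact_mod_cast le_max_left _ _)
    have hK : (0 : ℝ) < (K + 1 / 2) ^ 3 := by positivity
    have hS0 : (0 : ℝ) ≤ S := by positivity
    have hden : (0 : ℤ) < (2 * (K : ℤ) + 1) ^ 3 := by positivity
    have hcd := div_le_cdiv (a := 8 * max Ω.hi 0) hden
    have e : ∀ x y z : ℝ, x - y - z = x - (y + z) := fun x y z ↦ by ring
    rw [← e]
    calc |(∫ t in Ioc 0 (2 * a), 1 / (2 * Real.cosh (t / 2)) * Real.sin (π * n / a * t)) -
            (∑ k ∈ Finset.range K, (-1 : ℝ) ^ k *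
              (π * n / a * (1 - Real.exp (-((k + 1 / 2) * (2 * a)))) / ((k + 1 / 2) ^ 2 + (π * n / a) ^ 2))) -
            (-1 : ℝ) ^ K / 2 *
              (π * n / a * (1 - Real.exp (-((K + 1 / 2) * (2 * a)))) / ((K + 1 / 2) ^ 2 + (π * n / a) ^ 2))| * S
        ≤ (π * n / a) / (K + 1 / 2) ^ 3 * S := mul_le_mul_of_nonneg_right hrem hS0
      _ = (π * n / a * S) / (K + 1 / 2) ^ 3 := by ring
      _ ≤ ((max Ω.hi 0 : ℤ) : ℝ) / (K + 1 / 2) ^ 3 := div_le_div_of_nonneg_right hωS hK.le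
      _ = ((8 * max Ω.hi 0 : ℤ) : ℝ) / (((2 * (K : ℤ) + 1) ^ 3 : ℤ) : ℝ) := by
          push_cast; field_simp; ring
      _ ≤ _ := hcd
  · simp at h

/-- **The diagonal entry box, v2**: tail + `K` terms + half of term `K` (linear time), widened by
`⌈8·max(W.hi,0)/(2K+1)³⌉`. [cite: Moore1966, Ch. 3 (interval arithmetic: inclusion property)] -/
def diagBoxH (S Karc : ℕ) (P A EA Ω E0 R : MI) (K : ℕ) : Option MI :=
  match tailBox S Karc P EA, diagSum S A Ω E0 R K, diagTerm S A Ω (expSeq S E0 R K) K, diagRemBox S A Ω with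
  | some T, some Y, some t, some W =>
      some ((T.add (halfSigned K Y t)).widen (cdiv (8 * max W.hi 0) ((2 * (K : ℤ) + 1) ^ 3)))
  | _, _, _, _ => none

/-- ★ `diagBoxH` encloses `sechIncrCoeff a n n` (`Ω ∋ πn/a`, `n : ℕ`).
[cite: Moore1966, Ch. 3 (interval arithmetic: inclusion property)] -/
theorem mem_diagBoxH (hS : 0 < S) (ha : 0 < a) {Karc : ℕ} {P A EA Ω E0 R : MI} (hP : MI.mem S Real.pi P)
    (hA : MI.mem S a A) (hEA : MI.mem S (Real.exp a) EA) {n : ℕ} (hΩ : omegaBox S P A n = some Ω)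
    (hE0 : MI.mem S (Real.exp (-a)) E0) (hR : MI.mem S (Real.exp (-(2 * a))) R) {K : ℕ} {Y : MI}
    (h : diagBoxH S Karc P A EA Ω E0 R K = some Y) :
    MI.mem S (sechIncrCoeff a n n) Y := by
  have hω := mem_omegaBox hS hP hA hΩ
  unfold diagBoxH at h
  split at h
  · rename_i T Z t W hT hZ ht hW
    simp only [Option.some.injEq] at h
    subst h
    have hTm := mem_tailBox hS hP hEA hT
    have hZm := mem_diagSum hS ha hA hω hE0 hR K hZ
    have htm := mem_diagTerm hS ha hA hω (mem_expSeq hS hE0 hR K) ht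
    have hWm := mem_diagRemBox hS hA hω hW
    have hsum := MI.mem_add hTm (mem_halfSigned (K := K) hZm htm)
    refine MI.mem_widen hsum ?_
    have hrem := abs_sechDiag_sub_sum_half_le ha n K
    have hWS : (2 * a * (π * n / a) ^ 2 + 1 / a) * S ≤ ((max W.hi 0 : ℤ) : ℝ) := by
      have := hWm.2; push_cast; exact this.trans (by exact_mod_cast le_max_left _ _)
    have hK : (0 : ℝ) < (K + 1 / 2) ^ 3 := by positivity
    have hS0 : (0 : ℝ) ≤ S := by positivity
    have hden : (0 : ℤ) < (2 * (K : ℤ) + 1) ^ 3 := by positivity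
    have hcd := div_le_cdiv (a := 8 * max W.hi 0) hden
    have e : ∀ x t y z : ℝ, x - t - y - z = x - (t + (y + z)) := fun x t y z ↦ by ring
    rw [← e]
    calc _ ≤ (2 * a * (π * n / a) ^ 2 + 1 / a) / (K + 1 / 2) ^ 3 * S := mul_le_mul_of_nonneg_right hrem hS0
      _ = ((2 * a * (π * n / a) ^ 2 + 1 / a) * S) / (K + 1 / 2) ^ 3 := by ring
      _ ≤ ((max W.hi 0 : ℤ) : ℝ) / (K + 1 / 2) ^ 3 := div_le_div_of_nonneg_right hWS hK.le
      _ = ((8 * max W.hi 0 : ℤ) : ℝ) / (((2 * (K : ℤ) + 1) ^ 3 : ℤ) : ℝ) := by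
          push_cast; field_simp; ring
      _ ≤ _ := hcd
  · simp at h

end Boxes

end SechEncl

end Summit.Ventures.WeilGRH
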